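import Summits.HodgeConjecture.HodgeConjecture.Theorems.F0P3cStCharTSScFin        -- ★ p848548∕p848564 K1∕K2 «SC-FIN»∕«L2-FIN» (this seat)
import HarnessLib

/-!
# F0 · P3c · line LH6 «StCharTS» — «Sa-COMPOSE★» piece K4 «FIN-OF-L2»: IF EVERY MEMBER OF THE (β)-DATUM IS SQUARE-INTEGRABLE, ITS SUPPORT IS FINITE —
# the (b)-row half of the (S-a) head, hypothesis-fed from the TR carpets over `𝔇 : EllipticData G H`

Cell `pub/hodgecm-mathlib`, crux H413 = `stmt-HodgeConjecture-24833` (lane `--supports … --as helper`), route HCCMUnconditional; seat LH6-p05 (g0); desk F0P3b-plan (g23)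
deal 03:07:39Z «Sa-COMPOSE★» (organ (S-a) `stub_StSupportFiniteSqInt`, leaf `Cruxes/H413/Lines/F0_P3c_StCharTSPaydown.lean` ED. 1 :158).  THEOREMS ONLY, sorry-free, GENERIC
over `𝔇 : EllipticData G H`; imports ★ K1∕K2 only.
HONEST LABEL: HC_CM is proved only modulo the 7 printed citations (2 remaining: hLiu418 = `stmt-HodgeConjecture-24832`, h413 = `stmt-HodgeConjecture-24833`) until
rung 0 closes; count-neutral, hypothesis-fed.

THE MATHEMATICS.  [Rogawski1990, L. 12.7.2 proof pp. 193–194]: the organ (S-a) says «`supp a` finite AND every member square-integrable».  Print gets «square-integrable»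
from the torus step (rows (a)(c) of the road card `F0/P3b/LH6-p05/g0/ROAD-Sa.v1.md` — the part whose inputs no carpet states yet) and «finite» from the elliptic theory
(row (b)).  This file is the kernel form of the implication (S-a).2 ⇒ (S-a).1: once every member is square-integrable, the identity tested at a pseudo-coefficient `f_π` of a
member reads `⟨χ^G_ρ, χ_π⟩_e = a(π)` (two distinct square-integrable classes are `⟨ , ⟩_e`-orthogonal: Prop. 12.6.1 (a)(b) + «`ψ∘det`, `πⁿ(ξ)`, the l.d.s. members are not
square-integrable» §12.2), so `supp a ⊆ {π square-integrable : ⟨χ^G_ρ, χ_π⟩_e ≠ 0}`, which is finite by ★ «L2-FIN» (Bessel, «`χ^G_ρ` has bounded elliptic norm»).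
So the (S-a) HEAD = this file ∘ [rows (a)(c)], and its only inputs outside the carpets are the datum-coherence ∕ regularity sockets listed on the squad bus (03:31Z, 03:45Z,
03:52Z) for `Ch12Sec5Inputs` ED. 2.

* `not_isL2_of_isEllipticPair` — «an elliptic pair has at most one square-integrable member» from the sockets `DetNotL2`∕`PiNNotL2`∕`LdsNotL2` (LH6-p01's names).
* `innerG_eq_coeff_of_members_isL2` — `⟨x, χ_π⟩_e = aX(π)` for a member when all members are square-integrable.
* **`support_finite_of_members_isL2`** — (S-a).2 ⇒ (S-a).1.

## References
* [Rogawski1990] J. D. Rogawski, *Automorphic Representations of Unitary Groups in Three Variables*, Ann. of Math. Stud. 123 (1990): §12.7 L. 12.7.2 proof pp. 193–194;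
  §12.6 Prop. 12.6.1 p. 188; §12.2 pp. 173–174.
-/

set_option autoImplicit false
-- the mandated namespace has the single-problem summit's repeated segment (`HodgeConjecture.HodgeConjecture`)
set_option linter.dupNamespace false

noncomputable section

open MeasureTheory Filter Topology
open scoped BigOperators ComplexConjugate

namespace Summit.HodgeConjecture.HodgeConjecture.Cruxes.H413.F0P3cStCharTSFinOfL2

open Literature.NumberTheory.Rogawski1990.Ch12Sec5 Literature.NumberTheory.Rogawski1990 Literature.NumberTheory.Automorphic
open Summit.HodgeConjecture.HodgeConjecture.Cruxes.H413 Summit.HodgeConjecture.HodgeConjecture.Cruxes.H413.F0P3cStCharTSScFin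

variable {G H : Type} [Group G] [TopologicalSpace G] [IsTopologicalGroup G] [MeasurableSpace G]
  [∀ γ : G, MeasurableSpace (G ⧸ Subgroup.centralizer ({γ} : Set G))] [MeasurableSpace (G ⧸ Subgroup.center G)]
  [Group H] [TopologicalSpace H] [IsTopologicalGroup H] [MeasurableSpace H]
  (𝔇 : EllipticData G H)

/-! ## «FIN-OF-L2»: if every member is square-integrable, the support is finite — the (b)-row half of the (S-a) head

[Rogawski1990, L. 12.7.2 proof pp. 193–194]: once the torus step has removed every non-square-integrable member («This shows that X consists of finitely-many square-integrable
representations»), finiteness is the elliptic statement of §5: for a square-integrable member `π` the tested identity reads `⟨χ^G_ρ, χ_π⟩_e = a(π)` (no other member pairs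
with `χ_π`: two distinct square-integrable classes are `⟨ , ⟩_e`-orthogonal), so `supp a ⊆ {π L² : ⟨χ^G_ρ, χ_π⟩_e ≠ 0}`, finite by «L2-FIN».  Also recorded: the datum-level
fact «an elliptic pair has at most one square-integrable member» from the three sockets `DetNotL2`∕`PiNNotL2`∕`LdsNotL2` of the forthcoming carpet `Ch12Sec5Inputs` (LH6-p01's names). -/

/-- **«PAIRS-ONE-L2» from the three named sockets**: if `ψ∘det`, `πⁿ(ξ)` and the l.d.s. members are not square-integrable [§12.2 pp. 173–174], an elliptic pair (one of the
three kinds of Prop. 12.6.1 (b)) never consists of two square-integrable classes. [cite: Rogawski1990, §12.2 pp. 173–174; §12.6 Prop. 12.6.1 (b) p. 188] -/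
theorem not_isL2_of_isEllipticPair
    (hDet : ∀ ψ : ↥(Subgroup.center G) →* ℂˣ, Continuous ψ → ¬ 𝔇.IsL2 (𝔇.detG ψ))
    (hPiN : ∀ ξ' : H →* ℂˣ, Continuous ξ' → ¬ 𝔇.IsL2 (𝔇.piN ξ'))
    (hLds : ∀ P ∈ 𝔇.ldsPackets, ∀ σ ∈ P, ¬ 𝔇.IsL2 σ)
    (π π' : IrrClass G) (hpair : 𝔇.IsEllipticPair π π') (hπ : 𝔇.IsL2 π) : ¬ 𝔇.IsL2 π' := by
  intro hπ'
  rcases hpair with ⟨P, hP, hPmem⟩ | ⟨ψ, hψ, hψ'⟩ | ⟨ξ', hξ', hξ''⟩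
  · exact hLds P hP π ((hPmem π).2 (Or.inl rfl)) hπ
  · rcases hψ' with ⟨-, h2⟩ | ⟨h1, -⟩
    · exact hDet ψ hψ (h2 ▸ hπ')
    · exact hDet ψ hψ (h1 ▸ hπ)
  · rcases hξ'' with ⟨-, h2⟩ | ⟨h1, -⟩
    · exact hPiN ξ' hξ' (h2 ▸ hπ')
    · exact hPiN ξ' hξ' (h1 ▸ hπ)

/-- **The tested identity for a square-integrable member when ALL members are square-integrable**: `⟨x, χ_π⟩_{G,e} = aX(π)`.
[cite: Rogawski1990, §12.7 L. 12.7.2 proof pp. 193–194; §12.6 Prop. 12.6.1 p. 188] -/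
theorem innerG_eq_coeff_of_members_isL2
    (hTell : ∀ T ∈ 𝔇.cartanG, ∀ᵐ t : ↥T ∂(𝔇.μT T), (t : G) ∈ 𝔇.ellG)
    (hEllL2 : ∀ π : IrrClass G, 𝔇.IsL2 π → 𝔇.IsEllipticRep π)
    (hpairL2 : ∀ π π' : IrrClass G, 𝔇.IsEllipticPair π π' → 𝔇.IsL2 π → ¬ 𝔇.IsL2 π')
    (hPCT : Ch12Sec6.PseudoCoeffTrace 𝔇) (h61a : Ch12Sec6.Prop1261a 𝔇) (h61b : Ch12Sec6.Prop1261b 𝔇)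
    (S_H : (H → ℂ) → Prop) (M : (H → ℂ) → (G → ℂ) → Prop) (R : (H → ℂ) → ℂ)
    (hMT : ∀ (fH : H → ℂ) (φ : G → ℂ), M fH φ → 𝔇.IsTransfer φ fH)
    (aX : IrrClass G → ℤ) (hall : ∀ π : IrrClass G, aX π ≠ 0 → 𝔇.IsL2 π)
    (hid : ∀ (fH : H → ℂ) (φ : G → ℂ), S_H fH → φ ∈ SchwartzBruhat G → M fH φ →
      Summable (fun π : IrrClass G => (aX π : ℂ) * π.smoothTrace 𝔇.μG φ) ∧
        ∑' π : IrrClass G, (aX π : ℂ) * π.smoothTrace 𝔇.μG φ = R fH)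
    (x : G → ℂ)
    (hup : ∀ (π : IrrClass G) (f : G → ℂ) (fH : H → ℂ), 𝔇.IsPseudoCoeff π f → 𝔇.IsTransfer f fH → S_H fH → R fH = 𝔇.innerG x (𝔇.char π))
    {π : IrrClass G} (hπ : 𝔇.IsL2 π) {f : G → ℂ} (hf : 𝔇.IsPseudoCoeff π f) {fH : H → ℂ} (hfH : S_H fH) (hm : M fH f) :
    𝔇.innerG x (𝔇.char π) = (aX π : ℂ) := by
  classical
  have hell : 𝔇.IsEllipticRep π := hEllL2 π hπ
  obtain ⟨_, hsum⟩ := hid fH f hfH hf.1 hm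
  have hvanish : ∀ π' : IrrClass G, π' ≠ π → (aX π' : ℂ) * π'.smoothTrace 𝔇.μG f = 0 := by
    intro π' hne
    by_cases ha : aX π' = 0
    · rw [ha, Int.cast_zero, zero_mul]
    · rw [hPCT π π' f hf]
      refine mul_eq_zero_of_right _ ?_
      by_cases hell' : 𝔇.IsEllipticRep π'
      · by_contra hne0
        exact hpairL2 π' π (h61b π' π hell' hell hne0 hne) (hall π' ha) hπ
      · exact innerG_eq_zero_of_not_isEllipticRep 𝔇 hTell hell' _
  have htsum : ∑' π' : IrrClass G, (aX π' : ℂ) * π'.smoothTrace 𝔇.μG f = (aX π : ℂ) := by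
    rw [tsum_eq_single π hvanish, hPCT π π f hf, (h61a π hell).2 hπ, mul_one]
  rw [← hup π f fH hf (hMT fH f hm) hfH, ← hsum, htsum]

/-- **«FIN-OF-L2» — the (b)-row half of the (S-a) head**: if every member of the (β)-datum is square-integrable (the output of the torus step, rows (a)(c)), the support is
FINITE: `supp aX ⊆ {π square-integrable : ⟨x, χ_π⟩_e ≠ 0}`, finite by `finite_isL2_innerG_ne_zero`. [cite: Rogawski1990, §12.7 L. 12.7.2 proof pp. 193–194] -/
theorem support_finite_of_members_isL2
    (hTell : ∀ T ∈ 𝔇.cartanG, ∀ᵐ t : ↥T ∂(𝔇.μT T), (t : G) ∈ 𝔇.ellG)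
    (hEllL2 : ∀ π : IrrClass G, 𝔇.IsL2 π → 𝔇.IsEllipticRep π)
    (hpairL2 : ∀ π π' : IrrClass G, 𝔇.IsEllipticPair π π' → 𝔇.IsL2 π → ¬ 𝔇.IsL2 π')
    (hL2dom : ∀ π : IrrClass G, 𝔇.IsL2 π → ∀ T ∈ 𝔇.cartanG, MemLp (fun t : ↥T => (𝔇.DG (t : G) : ℂ) * 𝔇.char π (t : G)) 2 (𝔇.μT T))
    (hPCE : Ch12Sec6.PseudoCoeffExists 𝔇) (hPCT : Ch12Sec6.PseudoCoeffTrace 𝔇)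
    (h61a : Ch12Sec6.Prop1261a 𝔇) (h61b : Ch12Sec6.Prop1261b 𝔇) (h61c : Ch12Sec6.Prop1261c 𝔇)
    (S_H : (H → ℂ) → Prop) (M : (H → ℂ) → (G → ℂ) → Prop) (R : (H → ℂ) → ℂ)
    (hTv : ∀ φ : G → ℂ, φ ∈ SchwartzBruhat G → ∃ fH : H → ℂ, S_H fH ∧ M fH φ)
    (hMT : ∀ (fH : H → ℂ) (φ : G → ℂ), M fH φ → 𝔇.IsTransfer φ fH)
    (aX : IrrClass G → ℤ) (hall : ∀ π : IrrClass G, aX π ≠ 0 → 𝔇.IsL2 π)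
    (hid : ∀ (fH : H → ℂ) (φ : G → ℂ), S_H fH → φ ∈ SchwartzBruhat G → M fH φ →
      Summable (fun π : IrrClass G => (aX π : ℂ) * π.smoothTrace 𝔇.μG φ) ∧
        ∑' π : IrrClass G, (aX π : ℂ) * π.smoothTrace 𝔇.μG φ = R fH)
    (x : G → ℂ) (hx : ∀ T ∈ 𝔇.cartanG, MemLp (fun t : ↥T => (𝔇.DG (t : G) : ℂ) * x (t : G)) 2 (𝔇.μT T))
    (hup : ∀ (π : IrrClass G) (f : G → ℂ) (fH : H → ℂ), 𝔇.IsPseudoCoeff π f → 𝔇.IsTransfer f fH → S_H fH → R fH = 𝔇.innerG x (𝔇.char π)) :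
    (Function.support aX).Finite := by
  have hfin := finite_isL2_innerG_ne_zero 𝔇 hTell hEllL2 hpairL2 hL2dom hPCE hPCT h61a h61b h61c S_H M R hTv hMT aX hid x hx hup
  refine hfin.subset fun π hπ => ?_
  rw [Function.mem_support] at hπ
  have hL2 : 𝔇.IsL2 π := hall π hπ
  obtain ⟨f, hf⟩ := hPCE π (hEllL2 π hL2)
  obtain ⟨fH, hfH, hm⟩ := hTv f hf.1
  refine ⟨hL2, ?_⟩
  rw [innerG_eq_coeff_of_members_isL2 𝔇 hTell hEllL2 hpairL2 hPCT h61a h61b S_H M R hMT aX hall hid x hup hL2 hf hfH hm]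
  exact_mod_cast hπ

end Summit.HodgeConjecture.HodgeConjecture.Cruxes.H413.F0P3cStCharTSFinOfL2

end
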